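import Summits.Ventures.HodgeRepro2.T5SU11KernelCompositionTransform
import Summits.Ventures.HodgeRepro2.T5SU11KernelCompositionSign

/-!
# The exact `L¹(Ξ sinh 2t dt)`-norm of the composed kernels: `∫ |K_λ^{∘(k+1)}(t, s)| Ξ(t) sinh 2t dt = Ξ(s)/((λ − 1)²)^{k+1}`

Row 608's ground-state transform `∫ K_λ^{∘(k+1)}(t, s) Ξ(t) sinh 2t dt = (−1/(μ + 1))^{k+1} Ξ(s)` combined with row 592's constant
sign `|K_λ^{∘(k+1)}(t, s)| = (−1)^{k+1} K_λ^{∘(k+1)}(t, s)` gives the transform of the ABSOLUTE value exactly: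

* `integral_abs_kernel_comp_mul_sph_one` — **`∫ |K_λ^{∘(k+1)}(t, s)| Ξ(t) sinh 2t dt = Ξ(s)/((λ − 1)²)^{k+1}`**: the
  `L¹(Ξ sinh 2t dt)`-norm of the composed kernel `K_λ^{∘(k+1)}(·, s)` is exactly `Ξ(s)/((λ − 1)²)^{k+1}` — the power
  `(G^I_λ)^k` attains the norm `1/((λ − 1)²)^k` on every kernel source (rows 5xx gave `‖G^I_λ‖ = 1/(λ − 1)²` on `L¹(Ξ sinh)`);
* `integral_abs_kernel_mul_sph_one'` — the case `k = 0`: `∫ |K_λ(t, s)| Ξ(t) sinh 2t dt = Ξ(s)/(λ − 1)²` (row 556's row sum, in the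
  other variable by symmetry).

Nothing is claimed about (N).

Blind lane: Mathlib + the HodgeRepro2 prefix only; no sorry; axioms ⊆ {propext, Classical.choice,
Quot.sound}.
-/

namespace Summit.Ventures.HodgeRepro2.T5SU11KernelCompositionTransformAbs

open Filter Topology MeasureTheory
open Set (Ioi Ioc)
open T5SU11Cartan T5SU11SphericalFunction T5SU11SphericalDecay T5SU11RadialGreenKernel T5SU11RadialGreenImproper
  T5SU11KernelCompositionSign T5SU11KernelCompositionTransform

section measure

variable [MeasurableSpace Circle] [BorelSpace Circle]

variable {lam : ℝ} (hlam : 1 < lam) {s : ℝ} (hs : 0 < s)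

include hlam hs in
/-- **THE EXACT `L¹(Ξ sinh 2t dt)`-NORM OF THE COMPOSED KERNELS**:
`∫ |K_λ^{∘(k+1)}(t, s)| Ξ(t) sinh 2t dt = Ξ(s)/((λ − 1)²)^{k+1}` for every `k` and `s > 0`. -/
theorem integral_abs_kernel_comp_mul_sph_one (k : ℕ) :
    ∫ t in Ioi 0, |((greenSolI (fun t => sph lam (hyp t)) (sphDecay lam))^[k] (fun r => sphGreenKernel lam r s)) t|
        * sph 1 (hyp t) * Real.sinh (2 * t)
      = sph 1 (hyp s) / ((lam - 1) ^ 2) ^ (k + 1) := by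
  have e : ∀ t ∈ Ioi (0 : ℝ),
      |((greenSolI (fun t => sph lam (hyp t)) (sphDecay lam))^[k] (fun r => sphGreenKernel lam r s)) t|
          * sph 1 (hyp t) * Real.sinh (2 * t)
        = (-1 : ℝ) ^ (k + 1) * (((greenSolI (fun t => sph lam (hyp t)) (sphDecay lam))^[k]
          (fun r => sphGreenKernel lam r s)) t * sph 1 (hyp t) * Real.sinh (2 * t)) := by
    intro t ht
    rw [abs_kernel_comp_eq hlam k ht]
    ring
  rw [setIntegral_congr_fun measurableSet_Ioi e, integral_const_mul, transform_kernel_comp hlam hs k]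
  have hμ : lam * (lam - 2) + 1 = (lam - 1) ^ 2 := by ring
  have hne : (lam - 1) ^ 2 ≠ 0 := by
    have : 0 < lam - 1 := by linarith
    positivity
  rw [hμ]
  have e2 : (-1 : ℝ) ^ (k + 1) * ((-(1 / (lam - 1) ^ 2)) ^ (k + 1) * sph 1 (hyp s))
      = ((-1 : ℝ) * (-(1 / (lam - 1) ^ 2))) ^ (k + 1) * sph 1 (hyp s) := by
    rw [mul_pow]
    ring
  rw [e2]
  have e3 : (-1 : ℝ) * (-(1 / (lam - 1) ^ 2)) = 1 / (lam - 1) ^ 2 := by ring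
  rw [e3, one_div, inv_pow]
  field_simp

include hlam hs in
/-- The case `k = 0`: **`∫ |K_λ(t, s)| Ξ(t) sinh 2t dt = Ξ(s)/(λ − 1)²`**. -/
theorem integral_abs_kernel_mul_sph_one' :
    ∫ t in Ioi 0, |sphGreenKernel lam t s| * sph 1 (hyp t) * Real.sinh (2 * t) = sph 1 (hyp s) / (lam - 1) ^ 2 := by
  have h := integral_abs_kernel_comp_mul_sph_one hlam hs 0
  simpa only [Function.iterate_zero, id_eq, zero_add, pow_one] using h

end measure

end Summit.Ventures.HodgeRepro2.T5SU11KernelCompositionTransformAbs
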